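import Summits.Ventures.LatticeQCDFlow.Exactness.IMHColdStartMSE
import HarnessLib

/-!
# The cold start, second order: the sharp constant — `N²·(MSE_{x₀}(N) − MSE_π(N)) → (2w² − w)·δ² − w·σ²_f`

HONEST FRAMING: exact (Metropolis-corrected) sampling algorithms for lattice gauge theory;
figures of merit are autocorrelation/cost numbers at stated couplings and volumes; no
continuum-physics claim.

Venture `LatticeQCDFlow` (cell pub-lqcd), topic `Exactness`; FANOUT row 30 (lean-1, GEN-32).  NEW WORK of the
cell, general state space.  Setting of `IMHColdStartMSE` (this generation): `K = indepMH q w`, `w` normalised,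
maximal at `x₀`, `w = w(x₀)`, `r = 1 − 1/w`, `f` bounded measurable, `f̄ = f − π f`, `δ = f(x₀) − π f`,
`γ_u = autocov K π f̄ u`, `V = γ_0`, `σ²_f = γ_0 + 2Σ_{u≥1} γ_u` the Green–Kubo (`2τ_int`) variance,
`MSE_μ(N) = E_μ[(A_N − π f)²]` on path space.  The Scoring row proved `N·MSE_{μ₀}(N) → σ²_f` from EVERY start
(`Scoring/ChainMeanSquareErrorSharp`) and named the `O(1/N²)` term's sharp constant NOT CLAIMED.  For flow-MCMC
from the cold configuration `IMHColdStartMSE` gave `N²(MSE_{x₀} − MSE_π) = δ²P_N − Σ_{i,j<N} r^{min}γ_{|i−j|}`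
exactly; here the limit is taken:

* §1 **`sum_sum_pow_min_eq`** — the pair count by the smaller index and the gap:
  `Σ_{i,j<N} r^{min(i,j)}γ_{|i−j|} = Σ_{k<N} r^k·Σ_{u<N−k} c_u`, `c_0 = γ_0`, `c_u = 2γ_u` (`u ≥ 1`);
* §2 **`tendsto_oddPowSum`** — `Σ_{k<N}(2k+1)r^k → (1 + r)/(1 − r)²` (`0 ≤ r < 1`);
  **`tendsto_sum_pow_mul_partialSum`** — for `c ≥ 0` summable, `Σ_{k<N} r^k·Σ_{u<N−k} c_u → (1 − r)⁻¹·Σ_u c_u`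
  (Tannery's theorem, Mathlib `tendsto_tsum_of_dominated_convergence`, dominated by `r^k·Σ c`);
* §3 **`autocovWeights_facts`** — for `0 ≤ γ_u ≤ r^u V` the weights `c` are nonnegative and summable with
  `Σ_u c_u = γ_0 + 2Σ_{u≥1}γ_u`; for flow-MCMC at a mode (the tree's positivity and Doeblin envelope)
  **`imh_greenKubo_le`** — `σ²_f ≤ (2w − 1)·V`;
* §4 **`imh_chain_mse_mode_limit`** — THE SHARP SECOND-ORDER CONSTANT OF THE COLD START:
  `N²·(MSE_{x₀}(N) − MSE_π(N)) → (2w² − w)·δ² − w·σ²_f` as `N → ∞` (`(1 + r)/(1 − r)² = 2w² − w`, `(1 − r)⁻¹ = w`);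
  **`imh_chain_mse_mode_limit_nonneg_of_var_le`** — if `V ≤ δ²` (an observable extremal at the cold configuration)
  the limit is `≥ w(2w − 1)(δ² − V) ≥ 0`: the cold start HURTS at second order;
  **`imh_chain_mse_mode_limit_of_delta_eq_zero`** — if `f(x₀) = π f` the limit is `−w·σ²_f ≤ 0`: the cold start
  HELPS at second order (frozen at a point of zero error).

Reading (value-free): with `w = 1/A`, `A = Z/(c^{#B}M^k)` resp. `Z/∏_ℓ c_{#C_ℓ}` for the exact gauge samplers, the
cold-started time average has mean-square error `MSE_π(N) + [(2/A² − 1/A)·δf² − σ²_f/A]/N² + o(1/N²)`, where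
`N·MSE_π(N) → σ²_f` (the Scoring row) — the sharp form of the certified `16C'²/(ε²N²)` second-order term.  NOT CLAIMED:
a rate for the `o(1/N²)`; non-modal starts; the value of `σ²_f`.

No `sorry`, no new definitions, nothing cited as a fact; general measurable space with measurable singletons.
-/

noncomputable section

namespace Summit.Ventures.LatticeQCDFlow.Exactness

open MeasureTheory ProbabilityTheory Function Finset Filter Topology
open scoped ENNReal
open Summit.Ventures.LatticeQCDFlow.Scoring

variable {Ω : Type*} [MeasurableSpace Ω] [MeasurableSingletonClass Ω]
variable {q : Measure Ω} [IsProbabilityMeasure q] {w : Ω → ℝ}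

/-! ## §1 The pair count by the smaller index and the gap -/

omit [MeasurableSingletonClass Ω] [IsProbabilityMeasure q] in
/-- **`Σ_{i,j<N} r^{min(i,j)}·γ_{|i−j|} = Σ_{k<N} r^k·Σ_{u<N−k} c_u`** with `c_0 = γ_0`, `c_u = 2γ_u` for `u ≥ 1`.
[ours, combinatorics] -/
theorem sum_sum_pow_min_eq (r : ℝ) (γ : ℕ → ℝ) : ∀ N : ℕ,
    ∑ i ∈ range N, ∑ j ∈ range N, r ^ min i j * γ (Nat.dist i j) =
      ∑ k ∈ range N, r ^ k * ∑ u ∈ range (N - k), (if u = 0 then γ 0 else 2 * γ u)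
  | 0 => by simp
  | N + 1 => by
    -- peel the last row and column of the square
    have hrow : ∀ i ∈ range N, r ^ min i N * γ (Nat.dist i N) = r ^ i * γ (N - i) := fun i hi => by
      have hi' := (mem_range.1 hi).le
      rw [min_eq_left hi', Nat.dist_eq_sub_of_le hi']
    have hcol : ∀ j ∈ range N, r ^ min N j * γ (Nat.dist N j) = r ^ j * γ (N - j) := fun j hj => by
      have hj' := (mem_range.1 hj).le
      rw [min_eq_right hj', Nat.dist_eq_sub_of_le_right hj']
    have hsq : ∑ i ∈ range (N + 1), ∑ j ∈ range (N + 1), r ^ min i j * γ (Nat.dist i j) =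
        ∑ i ∈ range N, ∑ j ∈ range N, r ^ min i j * γ (Nat.dist i j) +
          2 * ∑ k ∈ range N, r ^ k * γ (N - k) + r ^ N * γ 0 := by
      rw [sum_range_succ]
      simp_rw [sum_range_succ]
      rw [sum_add_distrib, sum_congr rfl hrow, sum_congr rfl hcol, min_self, Nat.dist_self]
      ring
    -- peel the last term of the closed form and enlarge each inner window by one
    have hinner : ∀ k ∈ range N,
        r ^ k * ∑ u ∈ range (N + 1 - k), (if u = 0 then γ 0 else 2 * γ u) =
          r ^ k * ∑ u ∈ range (N - k), (if u = 0 then γ 0 else 2 * γ u) + 2 * (r ^ k * γ (N - k)) := by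
      intro k hk
      have hk' := (mem_range.1 hk).le
      have hNk : N - k ≠ 0 := Nat.sub_ne_zero_of_lt (mem_range.1 hk)
      rw [Nat.succ_sub hk', sum_range_succ, if_neg hNk]
      ring
    have hclosed : ∑ k ∈ range (N + 1), r ^ k * ∑ u ∈ range (N + 1 - k), (if u = 0 then γ 0 else 2 * γ u) =
        ∑ k ∈ range N, r ^ k * ∑ u ∈ range (N - k), (if u = 0 then γ 0 else 2 * γ u) +
          2 * ∑ k ∈ range N, r ^ k * γ (N - k) + r ^ N * γ 0 := by
      rw [sum_range_succ, sum_congr rfl hinner, sum_add_distrib, Nat.add_sub_cancel_left, sum_range_one,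
        if_pos rfl, ← mul_sum]
    rw [hsq, hclosed, sum_sum_pow_min_eq r γ N]

/-! ## §2 Two limits -/

omit [MeasurableSingletonClass Ω] [IsProbabilityMeasure q] in
/-- **`Σ_{k<N}(2k+1)r^k → (1 + r)/(1 − r)²`** for `0 ≤ r < 1`. [ours, calculus] -/
theorem tendsto_oddPowSum {r : ℝ} (hr0 : 0 ≤ r) (hr1 : r < 1) :
    Tendsto (fun N => ∑ k ∈ range N, (2 * (k : ℝ) + 1) * r ^ k) atTop (𝓝 ((1 + r) / (1 - r) ^ 2)) := by
  have hnorm : ‖r‖ < 1 := by rw [Real.norm_eq_abs, abs_of_nonneg hr0]; exact hr1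
  have h1 : HasSum (fun k : ℕ => (k : ℝ) * r ^ k) (r / (1 - r) ^ 2) := hasSum_coe_mul_geometric_of_norm_lt_one hnorm
  have h2 : HasSum (fun k : ℕ => r ^ k) (1 - r)⁻¹ := hasSum_geometric_of_lt_one hr0 hr1
  have h3 : HasSum (fun k : ℕ => (2 * (k : ℝ) + 1) * r ^ k) (2 * (r / (1 - r) ^ 2) + (1 - r)⁻¹) := by
    have h := (h1.mul_left 2).add h2
    refine h.congr_fun fun k => ?_
    ring
  have hval : 2 * (r / (1 - r) ^ 2) + (1 - r)⁻¹ = (1 + r) / (1 - r) ^ 2 := by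
    have h1r : (1 - r) ≠ 0 := (sub_pos.2 hr1).ne'
    field_simp
    ring_nf
  rw [← hval]
  exact h3.tendsto_sum_nat

omit [MeasurableSingletonClass Ω] [IsProbabilityMeasure q] in
/-- **`Σ_{k<N} r^k·Σ_{u<N−k} c_u → (1 − r)⁻¹·Σ_u c_u`** for `0 ≤ r < 1` and `c ≥ 0` summable (Tannery's theorem with
the dominating sequence `r^k·Σ c`). [ours, calculus] -/
theorem tendsto_sum_pow_mul_partialSum {r : ℝ} (hr0 : 0 ≤ r) (hr1 : r < 1) {c : ℕ → ℝ} (hc0 : ∀ u, 0 ≤ c u)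
    (hc : Summable c) :
    Tendsto (fun N => ∑ k ∈ range N, r ^ k * ∑ u ∈ range (N - k), c u) atTop
      (𝓝 ((1 - r)⁻¹ * ∑' u, c u)) := by
  set F : ℕ → ℕ → ℝ := fun N k => if k < N then r ^ k * ∑ u ∈ range (N - k), c u else 0 with hF
  have hpart : ∀ m, ∑ u ∈ range m, c u ≤ ∑' u, c u := fun m =>
    hc.sum_le_tsum (range m) fun u _ => hc0 u
  -- Tannery
  have hT : Tendsto (fun N => ∑' k, F N k) atTop (𝓝 (∑' k : ℕ, r ^ k * ∑' u, c u)) := by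
    refine tendsto_tsum_of_dominated_convergence (bound := fun k => r ^ k * ∑' u, c u)
      ((summable_geometric_of_lt_one hr0 hr1).mul_right _) (fun k => ?_) (Eventually.of_forall fun N k => ?_)
    · -- pointwise limit in `N` at fixed `k`
      have hlim : Tendsto (fun N => r ^ k * ∑ u ∈ range (N - k), c u) atTop (𝓝 (r ^ k * ∑' u, c u)) :=
        ((hc.tendsto_sum_tsum_nat.comp (tendsto_sub_atTop_nat k)).const_mul (r ^ k))
      refine hlim.congr' ?_
      filter_upwards [eventually_gt_atTop k] with N hN
      simp only [hF, if_pos hN]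
    · -- domination
      by_cases hk : k < N
      · simp only [hF, if_pos hk, Real.norm_eq_abs]
        rw [abs_of_nonneg (mul_nonneg (pow_nonneg hr0 k) (sum_nonneg fun u _ => hc0 u))]
        exact mul_le_mul_of_nonneg_left (hpart _) (pow_nonneg hr0 k)
      · simp only [hF, if_neg hk, norm_zero]
        exact mul_nonneg (pow_nonneg hr0 k) (tsum_nonneg hc0)
  have hfin : ∀ N, ∑' k, F N k = ∑ k ∈ range N, r ^ k * ∑ u ∈ range (N - k), c u := fun N => by
    rw [tsum_eq_sum (s := range N) (fun k hk => by simp only [hF, if_neg (fun h => hk (mem_range.2 h))])]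
    exact sum_congr rfl fun k hk => by simp only [hF, if_pos (mem_range.1 hk)]
  have hval : ∑' k : ℕ, r ^ k * ∑' u, c u = (1 - r)⁻¹ * ∑' u, c u := by
    rw [tsum_mul_right, tsum_geometric_of_lt_one hr0 hr1]
  simpa only [hfin, hval] using hT

/-! ## §3 The autocovariance weights: a pure-sequence lemma, then flow-MCMC at a mode -/

omit [MeasurableSingletonClass Ω] [IsProbabilityMeasure q] in
/-- For a sequence `0 ≤ γ_u ≤ r^u·V` (`0 ≤ r < 1`): the weights `c_0 = γ_0`, `c_u = 2γ_u` (`u ≥ 1`) are nonnegative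
and summable, `Σ_u c_u = γ_0 + 2Σ_{u≥1}γ_u`, and `γ_0 + 2Σ_{u≥1}γ_u ≤ (1 + r)/(1 − r)·V`. [ours, calculus] -/
theorem autocovWeights_facts {r V : ℝ} (hr0 : 0 ≤ r) (hr1 : r < 1) {γ : ℕ → ℝ} (h0 : ∀ u, 0 ≤ γ u)
    (hle : ∀ u, γ u ≤ r ^ u * V) :
    (∀ u, 0 ≤ (if u = 0 then γ 0 else 2 * γ u)) ∧
    Summable (fun u => if u = 0 then γ 0 else 2 * γ u) ∧
    ∑' u, (if u = 0 then γ 0 else 2 * γ u) = γ 0 + 2 * ∑' u, γ (u + 1) ∧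
    γ 0 + 2 * ∑' u, γ (u + 1) ≤ (1 + r) / (1 - r) * V := by
  have hV0 : 0 ≤ V := by have h := (h0 0).trans (hle 0); simpa using h
  have hnn : ∀ u, 0 ≤ (if u = 0 then γ 0 else 2 * γ u) := fun u => by
    split_ifs
    · exact h0 0
    · exact mul_nonneg zero_le_two (h0 u)
  have hdom : ∀ u, (if u = 0 then γ 0 else 2 * γ u) ≤ 2 * (r ^ u * V) := fun u => by
    split_ifs with hu
    · rw [hu]; linarith [hle 0, h0 0]
    · linarith [hle u]
  have hgeo : Summable fun u : ℕ => 2 * (r ^ u * V) :=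
    ((summable_geometric_of_lt_one hr0 hr1).mul_right V).mul_left 2
  have hsum : Summable fun u => (if u = 0 then γ 0 else 2 * γ u) := Summable.of_nonneg_of_le hnn hdom hgeo
  have hγs : Summable γ := by
    refine Summable.of_nonneg_of_le h0 (fun u => ?_) hsum
    split_ifs with hu
    · rw [hu]
    · linarith [h0 u]
  have hγs1 : Summable fun u => γ (u + 1) := (summable_nat_add_iff 1).2 hγs
  have hsplit : ∑' u, (if u = 0 then γ 0 else 2 * γ u) = γ 0 + 2 * ∑' u, γ (u + 1) := by
    rw [hsum.tsum_eq_zero_add, if_pos rfl, ← tsum_mul_left]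
    congr 1
  refine ⟨hnn, hsum, hsplit, ?_⟩
  -- `γ_0 + 2Σ_{u≥1} γ_u ≤ V + 2Σ_{u≥1} r^u V = V + 2 r V/(1 − r) = (1 + r)/(1 − r)·V`
  have h1r : 0 < 1 - r := sub_pos.2 hr1
  have htail : ∑' u, γ (u + 1) ≤ ∑' u : ℕ, r ^ (u + 1) * V :=
    Summable.tsum_le_tsum (fun u => hle (u + 1)) hγs1
      ((summable_nat_add_iff 1).2 ((summable_geometric_of_lt_one hr0 hr1).mul_right V))
  have hgeoval : ∑' u : ℕ, r ^ (u + 1) * V = r * (1 - r)⁻¹ * V := by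
    rw [tsum_mul_right]
    congr 1
    simp_rw [pow_succ']
    rw [tsum_mul_left, tsum_geometric_of_lt_one hr0 hr1]
  rw [hgeoval] at htail
  have hγ0 := hle 0
  rw [pow_zero, one_mul] at hγ0
  have hkey : γ 0 + 2 * ∑' u, γ (u + 1) ≤ V + 2 * (r * (1 - r)⁻¹ * V) := by linarith
  refine hkey.trans_eq ?_
  field_simp
  ring

omit [MeasurableSingletonClass Ω] in
/-- **For flow-MCMC at a mode**: the autocovariances `γ_u = autocov K π (f − π f) u` satisfy `0 ≤ γ_u ≤ r^u·V`
(the tree's positivity and Doeblin envelope), so the weights are summable and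
**`σ²_f = γ_0 + 2Σ_{u≥1}γ_u ≤ (2w(x₀) − 1)·Var_π f`** (`(1 + r)/(1 − r) = 2w − 1`; `τ_int ≤ w − 1/2` in variance
form). [ours] -/
theorem imh_greenKubo_le (hw : Measurable w) (hw0 : ∀ y, 0 < w y) {x₀ : Ω}
    (hmax : ∀ y, w y ≤ w x₀) [IsProbabilityMeasure (q.withDensity fun y => ENNReal.ofReal (w y))]
    {f : Ω → ℝ} (hf : Measurable f) {C : ℝ} (hC : ∀ x, |f x| ≤ C) :
    autocov (indepMH q w) (q.withDensity fun y => ENNReal.ofReal (w y))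
          (fun x => f x - ∫ z, f z ∂(q.withDensity fun y => ENNReal.ofReal (w y))) 0 +
        2 * ∑' u, autocov (indepMH q w) (q.withDensity fun y => ENNReal.ofReal (w y))
          (fun x => f x - ∫ z, f z ∂(q.withDensity fun y => ENNReal.ofReal (w y))) (u + 1) ≤
      (2 * w x₀ - 1) * ∫ x, (f x - ∫ z, f z ∂(q.withDensity fun y => ENNReal.ofReal (w y))) ^ 2
        ∂(q.withDensity fun y => ENNReal.ofReal (w y)) := by
  have hW : 1 ≤ w x₀ := one_le_of_mode (q := q) hmax
  have hWpos : 0 < w x₀ := hw0 x₀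
  have hr0 : 0 ≤ 1 - (w x₀)⁻¹ := sub_nonneg.2 (inv_le_one_of_one_le₀ hW)
  have hr1 : 1 - (w x₀)⁻¹ < 1 := sub_lt_self _ (inv_pos.2 hWpos)
  have hb := fun u => imh_autocov_centred_bounds (q := q) hw hw0 hmax hf hC u (x₀ := x₀)
  obtain ⟨-, -, -, hle⟩ := autocovWeights_facts hr0 hr1 (fun u => (hb u).1) (fun u => (hb u).2)
  have hval : (1 + (1 - (w x₀)⁻¹)) / (1 - (1 - (w x₀)⁻¹)) = 2 * w x₀ - 1 := by
    field_simp
    ring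
  rw [hval] at hle
  exact hle

/-! ## §4 The sharp second-order constant -/

/-- **THE SHARP SECOND-ORDER CONSTANT OF THE COLD START**: with `σ²_f = γ_0 + 2Σ_{u≥1}γ_u`,
`N²·(MSE_{x₀}(N) − MSE_π(N)) → (2w(x₀)² − w(x₀))·δ² − w(x₀)·σ²_f` as `N → ∞`. [ours] -/
theorem imh_chain_mse_mode_limit [Fact (Measurable w)] (hw0 : ∀ y, 0 < w y) {x₀ : Ω}
    (hmax : ∀ y, w y ≤ w x₀) [IsProbabilityMeasure (q.withDensity fun y => ENNReal.ofReal (w y))]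
    {f : Ω → ℝ} (hf : Measurable f) {C : ℝ} (hC : ∀ x, |f x| ≤ C) :
    Tendsto (fun N : ℕ => (N : ℝ) ^ 2 *
        (∫ x, ((∑ i ∈ Finset.range N, f (x i)) / N - ∫ z, f z ∂(q.withDensity fun y => ENNReal.ofReal (w y))) ^ 2
            ∂(Kernel.trajMeasure (X := fun _ : ℕ => Ω) (Measure.dirac x₀)
              (fun n : ℕ => (indepMH q w).comap (fun h : (i : ↥(Finset.Iic n)) → Ω => h ⟨n, Finset.mem_Iic.2 le_rfl⟩)
                (measurable_pi_apply _))) -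
          ∫ x, ((∑ i ∈ Finset.range N, f (x i)) / N - ∫ z, f z ∂(q.withDensity fun y => ENNReal.ofReal (w y))) ^ 2
            ∂(Kernel.trajMeasure (X := fun _ : ℕ => Ω) (q.withDensity fun y => ENNReal.ofReal (w y))
              (fun n : ℕ => (indepMH q w).comap (fun h : (i : ↥(Finset.Iic n)) → Ω => h ⟨n, Finset.mem_Iic.2 le_rfl⟩)
                (measurable_pi_apply _)))))
      atTop
      (𝓝 ((2 * w x₀ ^ 2 - w x₀) * (f x₀ - ∫ z, f z ∂(q.withDensity fun y => ENNReal.ofReal (w y))) ^ 2 -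
        w x₀ * (autocov (indepMH q w) (q.withDensity fun y => ENNReal.ofReal (w y))
            (fun x => f x - ∫ z, f z ∂(q.withDensity fun y => ENNReal.ofReal (w y))) 0 +
          2 * ∑' u, autocov (indepMH q w) (q.withDensity fun y => ENNReal.ofReal (w y))
            (fun x => f x - ∫ z, f z ∂(q.withDensity fun y => ENNReal.ofReal (w y))) (u + 1)))) := by
  have hW : 1 ≤ w x₀ := one_le_of_mode (q := q) hmax
  have hWpos : 0 < w x₀ := hw0 x₀
  have hr0 : 0 ≤ 1 - (w x₀)⁻¹ := sub_nonneg.2 (inv_le_one_of_one_le₀ hW)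
  have hr1 : 1 - (w x₀)⁻¹ < 1 := sub_lt_self _ (inv_pos.2 hWpos)
  have hb := fun u => imh_autocov_centred_bounds (q := q) (Fact.out : Measurable w) hw0 hmax hf hC u (x₀ := x₀)
  obtain ⟨hnn, hsum, hσ, -⟩ := autocovWeights_facts hr0 hr1 (fun u => (hb u).1) (fun u => (hb u).2)
  -- the two limits
  have hP := tendsto_oddPowSum hr0 hr1
  have hQ := tendsto_sum_pow_mul_partialSum hr0 hr1 hnn hsum
  -- values
  have hPval : (1 + (1 - (w x₀)⁻¹)) / (1 - (1 - (w x₀)⁻¹)) ^ 2 = 2 * w x₀ ^ 2 - w x₀ := by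
    field_simp
    ring
  have hQval : (1 - (1 - (w x₀)⁻¹))⁻¹ = w x₀ := by rw [sub_sub_cancel, inv_inv]
  rw [hPval] at hP
  rw [hQval, hσ] at hQ
  have hlim := (hP.const_mul ((f x₀ - ∫ z, f z ∂(q.withDensity fun y => ENNReal.ofReal (w y))) ^ 2)).sub hQ
  refine (hlim.congr' ?_).trans ?_
  · filter_upwards [eventually_ne_atTop 0] with N hN
    rw [imh_chain_mse_mode_sub_stationary hw0 hmax hf hC hN, sum_sum_pow_min_eq]
  · rw [mul_comm ((f x₀ - ∫ z, f z ∂(q.withDensity fun y => ENNReal.ofReal (w y))) ^ 2)]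

omit [MeasurableSingletonClass Ω] in
/-- **EXTREMAL OBSERVABLES: THE COLD START HURTS AT SECOND ORDER.**  If `Var_π f ≤ δ²` the limit
`(2w² − w)δ² − w·σ²_f` is at least `w(2w − 1)(δ² − Var_π f) ≥ 0`. [ours] -/
theorem imh_chain_mse_mode_limit_nonneg_of_var_le (hw : Measurable w) (hw0 : ∀ y, 0 < w y) {x₀ : Ω}
    (hmax : ∀ y, w y ≤ w x₀) [IsProbabilityMeasure (q.withDensity fun y => ENNReal.ofReal (w y))]
    {f : Ω → ℝ} (hf : Measurable f) {C : ℝ} (hC : ∀ x, |f x| ≤ C)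
    (hvar : ∫ x, (f x - ∫ z, f z ∂(q.withDensity fun y => ENNReal.ofReal (w y))) ^ 2
      ∂(q.withDensity fun y => ENNReal.ofReal (w y)) ≤
      (f x₀ - ∫ z, f z ∂(q.withDensity fun y => ENNReal.ofReal (w y))) ^ 2) :
    0 ≤ (2 * w x₀ ^ 2 - w x₀) * (f x₀ - ∫ z, f z ∂(q.withDensity fun y => ENNReal.ofReal (w y))) ^ 2 -
        w x₀ * (autocov (indepMH q w) (q.withDensity fun y => ENNReal.ofReal (w y))
            (fun x => f x - ∫ z, f z ∂(q.withDensity fun y => ENNReal.ofReal (w y))) 0 +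
          2 * ∑' u, autocov (indepMH q w) (q.withDensity fun y => ENNReal.ofReal (w y))
            (fun x => f x - ∫ z, f z ∂(q.withDensity fun y => ENNReal.ofReal (w y))) (u + 1)) := by
  have hW : 1 ≤ w x₀ := one_le_of_mode (q := q) hmax
  have hGK := imh_greenKubo_le (q := q) hw hw0 hmax hf hC (x₀ := x₀)
  have h2w : 0 ≤ 2 * w x₀ - 1 := by linarith
  have hw0' : 0 ≤ w x₀ := (hw0 x₀).le
  have h1 := mul_le_mul_of_nonneg_left hGK hw0'
  have h2 := mul_le_mul_of_nonneg_left hvar (mul_nonneg hw0' h2w)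
  nlinarith [h1, h2]

omit [MeasurableSingletonClass Ω] in
/-- **OBSERVABLES UNBIASED AT THE COLD CONFIGURATION: THE COLD START HELPS AT SECOND ORDER.**  If `f(x₀) = π f`
the limit is `−w·σ²_f ≤ 0`. [ours] -/
theorem imh_chain_mse_mode_limit_of_delta_eq_zero (hw : Measurable w) (hw0 : ∀ y, 0 < w y) {x₀ : Ω}
    (hmax : ∀ y, w y ≤ w x₀) [IsProbabilityMeasure (q.withDensity fun y => ENNReal.ofReal (w y))]
    {f : Ω → ℝ} (hf : Measurable f) {C : ℝ} (hC : ∀ x, |f x| ≤ C)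
    (hδ : f x₀ = ∫ z, f z ∂(q.withDensity fun y => ENNReal.ofReal (w y))) :
    (2 * w x₀ ^ 2 - w x₀) * (f x₀ - ∫ z, f z ∂(q.withDensity fun y => ENNReal.ofReal (w y))) ^ 2 -
        w x₀ * (autocov (indepMH q w) (q.withDensity fun y => ENNReal.ofReal (w y))
            (fun x => f x - ∫ z, f z ∂(q.withDensity fun y => ENNReal.ofReal (w y))) 0 +
          2 * ∑' u, autocov (indepMH q w) (q.withDensity fun y => ENNReal.ofReal (w y))
            (fun x => f x - ∫ z, f z ∂(q.withDensity fun y => ENNReal.ofReal (w y))) (u + 1)) =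
      -(w x₀ * (autocov (indepMH q w) (q.withDensity fun y => ENNReal.ofReal (w y))
            (fun x => f x - ∫ z, f z ∂(q.withDensity fun y => ENNReal.ofReal (w y))) 0 +
          2 * ∑' u, autocov (indepMH q w) (q.withDensity fun y => ENNReal.ofReal (w y))
            (fun x => f x - ∫ z, f z ∂(q.withDensity fun y => ENNReal.ofReal (w y))) (u + 1))) ∧
    -(w x₀ * (autocov (indepMH q w) (q.withDensity fun y => ENNReal.ofReal (w y))
            (fun x => f x - ∫ z, f z ∂(q.withDensity fun y => ENNReal.ofReal (w y))) 0 +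
          2 * ∑' u, autocov (indepMH q w) (q.withDensity fun y => ENNReal.ofReal (w y))
            (fun x => f x - ∫ z, f z ∂(q.withDensity fun y => ENNReal.ofReal (w y))) (u + 1))) ≤ 0 := by
  have hW : 1 ≤ w x₀ := one_le_of_mode (q := q) hmax
  have hr0 : 0 ≤ 1 - (w x₀)⁻¹ := sub_nonneg.2 (inv_le_one_of_one_le₀ hW)
  have hr1 : 1 - (w x₀)⁻¹ < 1 := sub_lt_self _ (inv_pos.2 (hw0 x₀))
  have hb := fun u => imh_autocov_centred_bounds (q := q) hw hw0 hmax hf hC u (x₀ := x₀)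
  obtain ⟨hnn, hsum, -⟩ := autocovWeights_facts hr0 hr1 (fun u => (hb u).1) (fun u => (hb u).2)
  have hσ0 : 0 ≤ autocov (indepMH q w) (q.withDensity fun y => ENNReal.ofReal (w y))
            (fun x => f x - ∫ z, f z ∂(q.withDensity fun y => ENNReal.ofReal (w y))) 0 +
          2 * ∑' u, autocov (indepMH q w) (q.withDensity fun y => ENNReal.ofReal (w y))
            (fun x => f x - ∫ z, f z ∂(q.withDensity fun y => ENNReal.ofReal (w y))) (u + 1) := by
    have h0 := hnn 0
    rw [if_pos rfl] at h0
    have h1 : 0 ≤ ∑' u, autocov (indepMH q w) (q.withDensity fun y => ENNReal.ofReal (w y))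
        (fun x => f x - ∫ z, f z ∂(q.withDensity fun y => ENNReal.ofReal (w y))) (u + 1) :=
      tsum_nonneg fun u => by
        have h := hnn (u + 1)
        rw [if_neg (Nat.succ_ne_zero u)] at h
        linarith
    linarith
  refine ⟨?_, ?_⟩
  · rw [hδ, sub_self, zero_pow two_ne_zero, mul_zero, zero_sub]
  · have := mul_nonneg (hw0 x₀).le hσ0
    linarith

end Summit.Ventures.LatticeQCDFlow.Exactness
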